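import Summits.ResolutionOfSingularities.ResolutionOfSingularities.Theorems.DescentDescentPerfectToAllSeparableBaseChange

/-!
# `DescentPerfectToAll` (stmt-ResolutionOfSingularities-0549) is decided on countable ground fields

Route `ResolutionOfSingularities/Descent`, crux `DescentPerfectToAll` (perfect ⇒ all ground fields of
characteristic `p`). Helper file (OURS; `--supports` the crux, does not close it; NOT a statement of
any manuscript).

**Theorem (`descentPerfectToAll_of_countable`, `descentPerfectToAll_iff_countable`).** The crux is
equivalent to its restriction to COUNTABLE ground fields: if, for every prime `p`, resolution over all
perfect fields of characteristic `p` implies resolution of every reduced separated scheme of finite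
type over every countable field of characteristic `p`, then `DescentPerfectToAll` holds (and
conversely, trivially).

Proof. A reduced separated `X/k` of finite type is defined over a finitely generated subfield
`K₀ = closure s` (`stub_fgModel`). By a Löwenheim–Skolem closure (`exists_countable_subfield_frobeniusLD`)
there is a COUNTABLE subfield `K ⊇ K₀` of `k` over which `k` is separable: close `s` under the
field operations and, for every finite family `a ⊆ K` admitting a non-trivial relation
`∑ λ_j^p a_j = 0` with `λ_j ∈ k`, under the coordinates of one such relation — so that `K` and `k^p`
are linearly disjoint over `K^p` (MacLane's criterion in the form (iii)); `linearIndepOn_pow_of_frobeniusLD`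
converts this into the form used throughout the tree ((ii): `K`-linearly independent finite families
of `k` have `K`-linearly independent `p`-th powers). The hypothesis resolves `X₀ ×_{K₀} K`, and
resolutions ascend along separable ground-field extensions
(`hasResolution_pullback_subtype_of_linearIndepOn_pow`, `DescentDescentPerfectToAllSeparableBaseChange.lean`),
so `X ≅ X₀ ×_{K₀} k` is resolvable.

Reading for the planners: WLOG the ground field of the crux is countable, hence an increasing union
`k = ⋃ₙ Kₙ` of a CHAIN of finitely generated fields (each resolvable under the antecedent), with
`k` separable over none of them in the residual case (`𝔽_p(t, s, …) ⊆ 𝔽_p((t))`).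
-/

noncomputable section

set_option linter.dupNamespace false -- mandated namespace of this single-conjunct summit

open CategoryTheory CategoryTheory.Limits AlgebraicGeometry TopologicalSpace
open Literature.AlgebraicGeometry.Resolution

namespace Summit.ResolutionOfSingularities.ResolutionOfSingularities.Theorems

universe u

/-! ## MacLane's criterion: linear disjointness form ⇒ the form used in the tree -/

/-- **MacLane (iii) ⇒ (ii).** Let `K ⊆ k` be a subfield (characteristic `p`) such that every finite
family `a ⊆ K` admitting a non-trivial relation `∑ λ_a^p · a = 0` with `λ_a ∈ k` already admits one
with `λ_a ∈ K` (`K` and `k^p` are linearly disjoint over `K^p`). Then `K`-linearly independent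
finite families of `k` have `K`-linearly independent `p`-th powers: expand the coefficients of a
relation `∑ g_i x_i^p = 0` in a `K^p`-independent family `(b)` spanning them over `K^p`,
`g_i = ∑_b c_{ib}^p b`, so that `∑_b (∑_i c_{ib} x_i)^p b = 0`; by the hypothesis and the
`K^p`-independence of `(b)` all `∑_i c_{ib} x_i` vanish, hence all `c_{ib}`, hence all `g_i`.
[cite: Matsumura1987, Thm. 26.4] -/
theorem linearIndepOn_pow_of_frobeniusLD {k : Type u} [Field k] (p : ℕ) [Fact p.Prime] [CharP k p]
    (K : Subfield k)
    (hLD : ∀ (v : Finset k), (↑v : Set k) ⊆ (K : Set k) → ∀ l : k → k,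
      (∑ a ∈ v, l a ^ p * a = 0) → (∃ a ∈ v, l a ≠ 0) →
      ∃ c : k → k, (∀ a ∈ v, c a ∈ K) ∧ (∃ a ∈ v, c a ≠ 0) ∧ ∑ a ∈ v, c a ^ p * a = 0)
    (s : Finset k) (hs : LinearIndepOn K _root_.id (↑s : Set k)) :
    LinearIndepOn K (fun x : k => x ^ p) (↑s : Set k) := by
  classical
  have hp : p.Prime := Fact.out
  haveI : ExpChar k p := ExpChar.prime hp
  haveI : CharP K p := K.subtype.charP Subtype.val_injective p
  rw [LinearIndepOn, linearIndependent_iff'] at hs ⊢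
  intro u g hrel
  -- `K^p ⊆ K` and a `K^p`-independent family `t` spanning the coefficients `g i`
  let Fp : Subfield K := (frobenius K p).fieldRange
  let T : Set K := ↑(u.image g)
  obtain ⟨t, htT, hspan, hlin⟩ := exists_linearIndependent Fp T
  have htfin : t.Finite := (Finset.finite_toSet _).subset htT
  set tF : Finset K := htfin.toFinset with htF
  have hmemtF : ∀ b : K, b ∈ tF ↔ b ∈ t := fun b => Set.Finite.mem_toFinset htfin
  -- coordinates `g i = ∑_{b ∈ tF} (c i b)^p * b`
  have hcoord : ∀ i ∈ u, ∃ c : K → K, (g i : K) = ∑ b ∈ tF, c b ^ p * b := by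
    intro i hi
    have hgi : g i ∈ Submodule.span Fp (↑tF : Set K) := by
      rw [Set.Finite.coe_toFinset, hspan]
      exact Submodule.subset_span (Finset.mem_coe.mpr (Finset.mem_image_of_mem g hi))
    obtain ⟨r, -, hr⟩ := Submodule.mem_span_finset.mp hgi
    choose c hc using fun b : K => (RingHom.mem_fieldRange.mp (r b).2)
    refine ⟨c, ?_⟩
    rw [← hr]
    refine Finset.sum_congr rfl fun b _ => ?_
    rw [Subfield.smul_def, smul_eq_mul, ← hc b]
    rfl
  choose! c hc using hcoord
  -- the relation rearranged along `t`: `∑_b (∑_i c i b • x_i)^p * b = 0`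
  let l : k → k := fun y => ∑ i ∈ u, (if h : y ∈ K then ((c i ⟨y, h⟩ : K) : k) else 0) * (i : k)
  have hl : ∀ b : K, l (b : k) = ∑ i ∈ u, ((c i b : K) : k) * (i : k) := by
    intro b
    refine Finset.sum_congr rfl fun i _ => ?_
    rw [dif_pos b.2]
  let v : Finset k := tF.image ((↑) : K → k)
  have hvK : (↑v : Set k) ⊆ (K : Set k) := by
    intro y hy
    obtain ⟨b, -, rfl⟩ := Finset.mem_image.mp (Finset.mem_coe.mp hy)
    exact b.2
  have hsumv : ∀ f : k → k, ∑ a ∈ v, f a = ∑ b ∈ tF, f (b : k) := fun f =>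
    Finset.sum_image fun b _ b' _ h => Subtype.val_injective h
  have hrelv : ∑ a ∈ v, l a ^ p * a = 0 := by
    rw [hsumv]
    simp_rw [hl, sum_pow_char p, mul_pow, Finset.sum_mul]
    rw [Finset.sum_comm, ← hrel]
    refine Finset.sum_congr rfl fun i hi => ?_
    rw [Algebra.smul_def, show algebraMap K k (g i) = ((g i : K) : k) from rfl, hc i hi]
    push_cast
    rw [Finset.sum_mul]
    refine Finset.sum_congr rfl fun b _ => ?_
    ring
  -- no coordinate family `b ↦ ∑_i c i b x_i` can be non-trivial: `t` is `K^p`-independent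
  have hmemt : ∀ b ∈ tF, b ∈ t := fun b hb => (hmemtF b).mp hb
  have hlzero : ∀ b ∈ tF, l (b : k) = 0 := by
    intro b₀ hb₀
    by_contra hb₀ne
    obtain ⟨c₀, hc₀K, ⟨a₀, ha₀, ha₀ne⟩, hc₀rel⟩ :=
      hLD v hvK l hrelv ⟨b₀, Finset.mem_image_of_mem _ hb₀, hb₀ne⟩
    -- the relation `∑_b (c₀ b)^p b = 0` in `K`, with coefficients in `K^p`
    let c₁ : K → K := fun b => if h : (b : k) ∈ v then ⟨c₀ b, hc₀K _ h⟩ else 0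
    have hc₁ : ∀ b ∈ tF, ((c₁ b : K) : k) = c₀ b := by
      intro b hb
      have h : (b : k) ∈ v := Finset.mem_image_of_mem ((↑) : K → k) hb
      simp only [c₁]
      rw [dif_pos h]
    have hrelK : ∑ b ∈ tF, c₁ b ^ p * b = 0 := by
      apply Subtype.val_injective
      push_cast
      rw [← hc₀rel, hsumv]
      refine Finset.sum_congr rfl fun b hb => ?_
      rw [hc₁ b hb]
    let r : K → Fp := fun b => ⟨c₁ b ^ p, RingHom.mem_fieldRange.mpr ⟨c₁ b, rfl⟩⟩
    have hr : ∀ b : K, ((r b : Fp) : K) = c₁ b ^ p := fun _ => rfl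
    have hrelt : ∑ x ∈ tF.subtype (· ∈ t), r (x : K) • ((x : t) : K) = 0 := by
      rw [Finset.sum_subtype_of_mem (fun b : K => r b • b) hmemt]
      simp_rw [Subfield.smul_def, smul_eq_mul, hr]
      exact hrelK
    have hli := linearIndependent_iff'.mp hlin (tF.subtype (· ∈ t)) (fun x => r (x : K)) hrelt
    obtain ⟨b₁, hb₁, rfl⟩ := Finset.mem_image.mp ha₀
    have h0 : c₁ b₁ ^ p = 0 := by
      have := hli ⟨b₁, hmemt b₁ hb₁⟩ (by rw [Finset.mem_subtype]; exact hb₁)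
      rw [← hr b₁, this]
      rfl
    apply ha₀ne
    rw [← hc₁ b₁ hb₁, pow_eq_zero_iff hp.ne_zero |>.mp h0]
    rfl
  -- each coordinate family is a `K`-relation among the `x_i`, hence vanishes; so do the `g i`
  have hczero : ∀ b ∈ tF, ∀ i ∈ u, c i b = 0 := by
    intro b hb i hi
    refine hs u (fun i => c i b) ?_ i hi
    rw [← hlzero b hb, hl]
    refine Finset.sum_congr rfl fun i _ => ?_
    rw [Algebra.smul_def]
    rfl
  intro i hi
  rw [hc i hi]
  refine Finset.sum_eq_zero fun b hb => ?_
  rw [hczero b hb i hi, zero_pow hp.ne_zero, zero_mul]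

/-! ## A countable subfield over which the field is separable (Löwenheim–Skolem closure) -/

/-- A finite subset of an increasing union `⋃ₙ Sₙ` lies in some `Sₙ`. [folklore] -/
theorem exists_finset_subset_of_monotone {α : Type u} (S : ℕ → Set α) (hS : Monotone S)
    (v : Finset α) (hv : (↑v : Set α) ⊆ ⋃ n, S n) : ∃ n, (↑v : Set α) ⊆ S n := by
  classical
  induction v using Finset.induction_on with
  | empty => exact ⟨0, by simp⟩
  | insert a v ha ih =>
    rw [Finset.coe_insert] at hv
    obtain ⟨n, hn⟩ := ih ((Set.subset_insert _ _).trans hv)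
    obtain ⟨m, hm⟩ := Set.mem_iUnion.mp (hv (Set.mem_insert _ _))
    refine ⟨max n m, ?_⟩
    rw [Finset.coe_insert]
    exact Set.insert_subset ((hS (le_max_right n m)) hm) (hn.trans (hS (le_max_left n m)))

/-- **Countable separable hull.** For a field `k` of characteristic `p` and a countable subset
`s₀ ⊆ k` there is a COUNTABLE subfield `K ⊇ s₀` of `k` such that every finite family `a ⊆ K`
admitting a non-trivial relation `∑ λ_a^p · a = 0` with coefficients `λ_a ∈ k` admits one with
coefficients in `K` — i.e. `K` and `k^p` are linearly disjoint over `K^p`, MacLane's criterion for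
the separability of `k/K`. Construction: close `s₀ ∪ {0, 1}` countably often under the field
operations and under the coordinates of one chosen witness relation per finite family.
[cite: Matsumura1987, Thm. 26.4] -/
theorem exists_countable_subfield_frobeniusLD {k : Type u} [Field k] (p : ℕ) (s₀ : Set k)
    (hs₀ : s₀.Countable) :
    ∃ K : Subfield k, s₀ ⊆ (K : Set k) ∧ (K : Set k).Countable ∧
      ∀ (v : Finset k), (↑v : Set k) ⊆ (K : Set k) → ∀ l : k → k,
        (∑ a ∈ v, l a ^ p * a = 0) → (∃ a ∈ v, l a ≠ 0) →
        ∃ c : k → k, (∀ a ∈ v, c a ∈ K) ∧ (∃ a ∈ v, c a ≠ 0) ∧ ∑ a ∈ v, c a ^ p * a = 0 := by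
  classical
  -- one chosen witness relation per finite family
  let bad : Finset k → Prop := fun v =>
    ∃ l : k → k, (∑ a ∈ v, l a ^ p * a = 0) ∧ ∃ a ∈ v, l a ≠ 0
  let W : Finset k → k → k := fun v => if h : bad v then Classical.choose h else 0
  have hW : ∀ v, bad v → (∑ a ∈ v, W v a ^ p * a = 0) ∧ ∃ a ∈ v, W v a ≠ 0 := by
    intro v h
    simp only [W, dif_pos h]
    exact Classical.choose_spec h
  -- one closure step, and the tower
  let step : Set k → Set k := fun S =>
    S ∪ Set.image2 (· + ·) S S ∪ Set.image2 (· * ·) S S ∪ (fun x => -x) '' S ∪ (fun x => x⁻¹) '' S ∪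
      ⋃ v ∈ {v : Finset k | (↑v : Set k) ⊆ S}, W v '' (↑v : Set k)
  let S : ℕ → Set k := fun n => Nat.rec (s₀ ∪ {0, 1}) (fun _ T => step T) n
  have hS0 : S 0 = s₀ ∪ {0, 1} := rfl
  have hSsucc : ∀ n, S (n + 1) = step (S n) := fun n => rfl
  have hsub : ∀ n, S n ⊆ S (n + 1) := fun n x hx => by
    rw [hSsucc]
    exact Or.inl (Or.inl (Or.inl (Or.inl (Or.inl hx))))
  have hmono : Monotone S := monotone_nat_of_le_succ hsub
  have hadd : ∀ n, ∀ x ∈ S n, ∀ y ∈ S n, x + y ∈ S (n + 1) := fun n x hx y hy => by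
    rw [hSsucc]
    exact Or.inl (Or.inl (Or.inl (Or.inl (Or.inr ⟨x, hx, y, hy, rfl⟩))))
  have hmul : ∀ n, ∀ x ∈ S n, ∀ y ∈ S n, x * y ∈ S (n + 1) := fun n x hx y hy => by
    rw [hSsucc]
    exact Or.inl (Or.inl (Or.inl (Or.inr ⟨x, hx, y, hy, rfl⟩)))
  have hneg : ∀ n, ∀ x ∈ S n, -x ∈ S (n + 1) := fun n x hx => by
    rw [hSsucc]
    exact Or.inl (Or.inl (Or.inr ⟨x, hx, rfl⟩))
  have hinv : ∀ n, ∀ x ∈ S n, x⁻¹ ∈ S (n + 1) := fun n x hx => by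
    rw [hSsucc]
    exact Or.inl (Or.inr ⟨x, hx, rfl⟩)
  have hwit : ∀ n (v : Finset k), (↑v : Set k) ⊆ S n → ∀ a ∈ v, W v a ∈ S (n + 1) :=
    fun n v hv a ha => by
      rw [hSsucc]
      refine Or.inr (Set.mem_iUnion₂.mpr ⟨v, hv, a, Finset.mem_coe.mpr ha, rfl⟩)
  -- countability
  have hcount : ∀ n, (S n).Countable := by
    intro n
    induction n with
    | zero =>
      rw [hS0]
      exact hs₀.union (((Set.finite_singleton (1 : k)).insert 0).countable)
    | succ n ih =>
      rw [hSsucc]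
      refine ((((ih.union (ih.image2 ih _)).union (ih.image2 ih _)).union (ih.image _)).union
        (ih.image _)).union ?_
      have hI : {v : Finset k | (↑v : Set k) ⊆ S n}.Countable := by
        have h1 : {t : Set k | t.Finite ∧ t ⊆ S n}.Countable := Set.countable_setOf_finite_subset ih
        have h2 : {v : Finset k | (↑v : Set k) ⊆ S n} =
            ((↑) : Finset k → Set k) ⁻¹' {t : Set k | t.Finite ∧ t ⊆ S n} := by
          ext v
          simp
        rw [h2]
        exact h1.preimage Finset.coe_injective
      exact hI.biUnion fun v _ => (Finset.countable_toSet v).image _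
  -- the union is a subfield
  let K : Subfield k :=
    { carrier := ⋃ n, S n
      mul_mem' := by
        intro x y hx hy
        obtain ⟨m, hm⟩ := Set.mem_iUnion.mp hx
        obtain ⟨n, hn⟩ := Set.mem_iUnion.mp hy
        exact Set.mem_iUnion.mpr ⟨max m n + 1, hmul _ x (hmono (le_max_left m n) hm) y
          (hmono (le_max_right m n) hn)⟩
      one_mem' := Set.mem_iUnion.mpr ⟨0, by rw [hS0]; simp⟩
      add_mem' := by
        intro x y hx hy
        obtain ⟨m, hm⟩ := Set.mem_iUnion.mp hx
        obtain ⟨n, hn⟩ := Set.mem_iUnion.mp hy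
        exact Set.mem_iUnion.mpr ⟨max m n + 1, hadd _ x (hmono (le_max_left m n) hm) y
          (hmono (le_max_right m n) hn)⟩
      zero_mem' := Set.mem_iUnion.mpr ⟨0, by rw [hS0]; simp⟩
      neg_mem' := by
        intro x hx
        obtain ⟨m, hm⟩ := Set.mem_iUnion.mp hx
        exact Set.mem_iUnion.mpr ⟨m + 1, hneg _ x hm⟩
      inv_mem' := by
        intro x hx
        obtain ⟨m, hm⟩ := Set.mem_iUnion.mp hx
        exact Set.mem_iUnion.mpr ⟨m + 1, hinv _ x hm⟩ }
  have hKcoe : (K : Set k) = ⋃ n, S n := rfl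
  refine ⟨K, ?_, ?_, ?_⟩
  · intro x hx
    rw [hKcoe]
    exact Set.mem_iUnion.mpr ⟨0, by rw [hS0]; exact Or.inl hx⟩
  · rw [hKcoe]
    exact Set.countable_iUnion hcount
  · intro v hv l hrel hne
    rw [hKcoe] at hv
    obtain ⟨n, hn⟩ := exists_finset_subset_of_monotone S hmono v hv
    have hbad : bad v := ⟨l, hrel, hne⟩
    refine ⟨W v, fun a ha => ?_, (hW v hbad).2, (hW v hbad).1⟩
    rw [← SetLike.mem_coe, hKcoe]
    exact Set.mem_iUnion.mpr ⟨n + 1, hwit n v hn a ha⟩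

/-- **Countable separable hull, MacLane form.** For a field `k` of characteristic `p` and a finite
`s₀ ⊆ k` there is a countable subfield `K ⊇ s₀` over which `k` is separable in MacLane's sense:
`K`-linearly independent finite families of `k` have `K`-linearly independent `p`-th powers.
[cite: Matsumura1987, Thm. 26.4] -/
theorem exists_countable_subfield_linearIndepOn_pow {k : Type u} [Field k] (p : ℕ) [Fact p.Prime]
    [CharP k p] (s₀ : Finset k) :
    ∃ K : Subfield k, (↑s₀ : Set k) ⊆ (K : Set k) ∧ (K : Set k).Countable ∧
      ∀ u : Finset k, LinearIndepOn K _root_.id (↑u : Set k) →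
        LinearIndepOn K (fun x : k => x ^ p) (↑u : Set k) := by
  obtain ⟨K, hs, hc, hLD⟩ := exists_countable_subfield_frobeniusLD p (↑s₀ : Set k)
    (Finset.countable_toSet s₀)
  exact ⟨K, hs, hc, fun u hu => linearIndepOn_pow_of_frobeniusLD p K hLD u hu⟩

/-! ## The reduction of the crux to countable ground fields -/

/-- **`DescentPerfectToAll` follows from its restriction to countable ground fields.** Suppose that
for every prime `p`, resolution over all perfect fields of characteristic `p` implies resolution of
every reduced separated scheme of finite type over every COUNTABLE field of characteristic `p`.
Then it implies resolution over EVERY field of characteristic `p` (the statement of the crux, in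
binder form): descend `X` to a finitely generated `K₀` (`stub_fgModel`), enlarge `K₀` to a countable
`K ⊆ k` with `k/K` separable (`exists_countable_subfield_linearIndepOn_pow`), resolve
`X₀ ×_{K₀} K` by the hypothesis, and ascend along `k/K`
(`hasResolution_pullback_subtype_of_linearIndepOn_pow`). [folklore] -/
theorem descentPerfectToAll_of_countable
    (h : ∀ p : ℕ, p.Prime → (∀ (κ : Type) [Field κ] [CharP κ p] [PerfectField κ] (Z : Scheme.{0})
      (g : Z ⟶ Spec (.of κ)), IsSeparated g → LocallyOfFiniteType g → QuasiCompact g →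
        IsReduced Z → Scheme.HasResolution Z) →
      ∀ (k : Type) [Field k] [CharP k p], Countable k → ∀ (X : Scheme.{0})
        (f : X ⟶ Spec (.of k)), IsSeparated f → LocallyOfFiniteType f → QuasiCompact f →
          IsReduced X → Scheme.HasResolution X) :
    ∀ p : ℕ, p.Prime → (∀ (κ : Type) [Field κ] [CharP κ p] [PerfectField κ] (Z : Scheme.{0})
      (g : Z ⟶ Spec (.of κ)), IsSeparated g → LocallyOfFiniteType g → QuasiCompact g →
        IsReduced Z → Scheme.HasResolution Z) →
      ∀ (k : Type) [Field k] [CharP k p] (X : Scheme.{0}) (f : X ⟶ Spec (.of k)),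
        IsSeparated f → LocallyOfFiniteType f → QuasiCompact f → IsReduced X →
          Scheme.HasResolution X := by
  intro p hp H k _ _ X f hsep hlft hqc hred
  classical
  haveI : Fact p.Prime := ⟨hp⟩
  -- finitely generated field of definition
  obtain ⟨K₀, s, hK₀, X₀, f₀, h₁, h₂, h₃, h₄, ⟨e⟩⟩ := stub_fgModel k X f hsep hlft hqc hred
  haveI := h₁; haveI := h₂; haveI := h₃; haveI := h₄; haveI := hred
  haveI : IsReduced (pullback f₀ (Spec.map (CommRingCat.ofHom K₀.subtype))) :=
    isReduced_of_isOpenImmersion e.inv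
  -- a countable separable hull `K ⊇ K₀`
  obtain ⟨K, hsK, hKc, hML⟩ := exists_countable_subfield_linearIndepOn_pow p s
  have hK₀K : K₀ ≤ K := by
    rw [hK₀, Subfield.closure_le]
    exact hsK
  haveI : CharP K p := K.subtype.charP Subtype.val_injective p
  have hKcount : Countable K := hKc.to_subtype
  -- resolve the countable level
  set ι₁ := Spec.map (CommRingCat.ofHom (Subfield.inclusion hK₀K)) with hι₁
  haveI : IsReduced (pullback f₀ ι₁) := isReduced_pullback_inclusion K₀ K hK₀K f₀
  have hresK : Scheme.HasResolution (pullback f₀ ι₁) :=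
    h p hp H K hKcount _ (pullback.snd f₀ ι₁) inferInstance inferInstance inferInstance
      inferInstance
  -- ascend along the separable extension `k/K`
  haveI : ExpChar k p := ExpChar.prime hp
  have hk := hasResolution_pullback_subtype_of_linearIndepOn_pow p hp K hML
    (pullback.snd f₀ ι₁) hresK
  have hcomp : K.subtype.comp (Subfield.inclusion hK₀K) = K₀.subtype := RingHom.ext fun _ => rfl
  have ecomp : Spec.map (CommRingCat.ofHom K.subtype) ≫ ι₁ =
      Spec.map (CommRingCat.ofHom K₀.subtype) := by
    rw [hι₁, ← Spec.map_comp, ← CommRingCat.ofHom_comp, hcomp]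
  exact (hk.of_iso (pullbackLeftPullbackSndIso f₀ ι₁ (Spec.map (CommRingCat.ofHom K.subtype)) ≪≫
    pullback.congrHom rfl ecomp).hom).of_iso e.inv

/-- **The crux is equivalent to its countable-ground-field restriction** (both in binder form:
`DescentPerfectToAll` on the left-hand side is literally the crux's statement). [folklore] -/
theorem descentPerfectToAll_iff_countable :
    (∀ p : ℕ, p.Prime → (∀ (κ : Type) [Field κ] [CharP κ p] [PerfectField κ] (Z : Scheme.{0})
      (g : Z ⟶ Spec (.of κ)), IsSeparated g → LocallyOfFiniteType g → QuasiCompact g →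
        IsReduced Z → Scheme.HasResolution Z) →
      ∀ (k : Type) [Field k] [CharP k p] (X : Scheme.{0}) (f : X ⟶ Spec (.of k)),
        IsSeparated f → LocallyOfFiniteType f → QuasiCompact f → IsReduced X →
          Scheme.HasResolution X) ↔
    (∀ p : ℕ, p.Prime → (∀ (κ : Type) [Field κ] [CharP κ p] [PerfectField κ] (Z : Scheme.{0})
      (g : Z ⟶ Spec (.of κ)), IsSeparated g → LocallyOfFiniteType g → QuasiCompact g →
        IsReduced Z → Scheme.HasResolution Z) →
      ∀ (k : Type) [Field k] [CharP k p], Countable k → ∀ (X : Scheme.{0})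
        (f : X ⟶ Spec (.of k)), IsSeparated f → LocallyOfFiniteType f → QuasiCompact f →
          IsReduced X → Scheme.HasResolution X) :=
  ⟨fun h p hp H k _ _ _ X f a b c d => h p hp H k X f a b c d, descentPerfectToAll_of_countable⟩

end Summit.ResolutionOfSingularities.ResolutionOfSingularities.Theorems

end
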